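import Mathlib
import HarnessLib.Audit
import Summits.PneNP.PneNP.Theorems.PstarTwoCleanExact
import Summits.PneNP.PneNP.Theorems.PstarCleanCutAssembly

/-!
# The exact-menu criterion and the JOINT census node (ROUND-24, O1; memo g24 §34)

FRONTIER range-avoidance ladder, rung F-N3, ROUND 24 (cell `pnp-ideate`, prover-2 memo `g24/O1-NOFREEVERTEX-g24.md` §34; typed targets
`PstarCoreBoundTargets.TerminalFive` / `TerminalPeelable` (p646951); restricted-model proof complexity — nothing here bears on `P` versus `NP`).

The kernel criterion for EXACT-MENU genericity (`PstarSliceGenericExact.SliceGenericExact I y J₀ c G`): a reader with monomial set exactly `G`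
failing on a slice has a pair-core (`sliceGenericExact_of_no_pairCore`, the proof of `PstarTerminalPeelableTwelve.sliceGeneric_of_no_pairCore'`
for one `G`), whose normal form (`PstarPairCoreNormal.PairCore.normalForm`) is a coincidence (branch (B), `NoShortCoincidence` for the menu `G`)
or a path-sum sub-core whose second reader has monomial set `G ∪ F₂` EXACTLY (branch (A)):

* `NoPathSumSubcoreExact I r y J₀ c G` (all sub-core sizes) / `NoSmallPathSumSubcoreExact` (at most five members) — as
  `PstarSliceGenericCriterion.NoPathSumSubcoreLin` / `PstarTerminalFiveAssembly.NoSmallPathSumSubcore` with `d₂.G = G ∪ F₂` in place of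
  `d₂.G ⊆ 𝒢 ∪ F₂`; `noSmallPathSumSubcoreExact_of_subset` (the inclusion node for a menu `M ⊇ G` implies the exact node for `G`),
  `noShortCoincidence_anti` (branch (B) is antitone in the menu);
* **`sliceGenericExact_of_criterion`**: `NoPathSumSubcoreExact ∧ NoShortCoincidence ⟹ SliceGenericExact` (menu `G` disjoint from `J₀`,
  `#(J₀ ∪ G) ≤ r`); `noPathSumSubcoreExact_of_small` under the induction hypothesis;
* node **`MenuCriterionBound`** (OPEN, census-type, JOINT IN THE MENU): on every covered, anchored terminal core with a centre and no clean cut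
  crossed twice, there is `ℬ ⊆ J₀`, `#ℬ + 2 ≤ #sharedSlots`, such that every skeleton-connected outside-gated chord `c ∉ ℬ` satisfies, for EACH of
  the four menus `G ∈ {∅, internalMenu G₁, internalMenu G₂, internalMenu (G₁ ∆ G₂)}`, `NoSmallPathSumSubcoreExact c G ∧ NoShortCoincidence c G`;
* **`terminalFive_of_menuBound : TerminalFiveA → MenuCriterionBound → TerminalFive`** (strong induction; crossing chords by
  `PstarCleanCut.smallCriterion_of_crossing`, the others by the node; kill by `PstarTwoCleanExact.false_of_two_clean_exact`);
  `terminalPeelable_of_menuBound`.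

For the census this means: the adversary commits the two internal menus once (joint budget), and a chord fails only through a certificate whose
second reader carries a whole channel menu.
-/

set_option linter.dupNamespace false -- `Summit.PneNP.PneNP.…`: summit = sub-problem name (D-0017 single-conjunct layout)

open Finset Module Literature.Computability.Complexity
open scoped symmDiff
open Summit.PneNP.PneNP.Theorems.PstarTyped (Typed)
open Summit.PneNP.PneNP.Theorems.PstarSALevel (varSet bdry BoundaryExpanding SimpleOverlap)
open Summit.PneNP.PneNP.Theorems.PstarXCore (xpair mem_xpair xverts)
open Summit.PneNP.PneNP.Theorems.PstarGapOneAll (gval)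
open Summit.PneNP.PneNP.Theorems.PstarGSat (gSat)
open Summit.PneNP.PneNP.Theorems.PstarCoreBound (XorClosed)
open Summit.PneNP.PneNP.Theorems.PstarChordRepair (IsChord)
open Summit.PneNP.PneNP.Theorems.PstarCoreBoundTargets (Terminal TerminalFive TerminalFiveA TerminalPeelable nonchords nonchords_subset mem_nonchords
  terminalPeelable_of_terminalFive)
open Summit.PneNP.PneNP.Theorems.PstarSharingBound (sharedSlots)
open Summit.PneNP.PneNP.Theorems.PstarChordBridgeTools (xpdeg)
open Summit.PneNP.PneNP.Theorems.PstarChordBridgeCentre (exists_maximal_peelable_sup)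
open Summit.PneNP.PneNP.Theorems.PstarNorUnitAssembly (xpdeg_singleton_of_mem)
open Summit.PneNP.PneNP.Theorems.PstarChordReadsMirror (gval_pair)
open Summit.PneNP.PneNP.Theorems.PstarChordReadLemma (SliceGeneric)
open Summit.PneNP.PneNP.Theorems.PstarChordReadOutside (OutsideGated)
open Summit.PneNP.PneNP.Theorems.PstarChordReadPairCore (PairCore phi_of_forall_ne)
open Summit.PneNP.PneNP.Theorems.PstarProductRank (polar IsInducedMatching)
open Summit.PneNP.PneNP.Theorems.PstarQuadRank (rad)
open Summit.PneNP.PneNP.Theorems.PstarPairCoreNormal (PairCore.normalForm)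
open Summit.PneNP.PneNP.Theorems.PstarPairCoreNoChord (no_chord_in_coincidence)
open Summit.PneNP.PneNP.Theorems.PstarCoincidenceMatching (card_chords_le_two_of_rank_lt_six card_inducedMatching_le_two_of_rank_lt_six)
open Summit.PneNP.PneNP.Theorems.PstarCleanChordCount (exists_clean_chords)
open Summit.PneNP.PneNP.Theorems.PstarTerminalPeelableTwelve (exists_centre_of_not_peelable)
open Summit.PneNP.PneNP.Theorems.PstarSliceGenericCriterion (NoShortCoincidence)
open Summit.PneNP.PneNP.Theorems.PstarSliceGenericInternal (internalMenu internalMenu_subset)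
open Summit.PneNP.PneNP.Theorems.PstarTerminalFiveAssembly (NoSmallPathSumSubcore)
open Summit.PneNP.PneNP.Theorems.PstarNoFreeVertex (Covered covered_of_terminal outsideGated_anti)
open Summit.PneNP.PneNP.Theorems.PstarHangingForest (Anchored anchored_of_terminal)
open Summit.PneNP.PneNP.Theorems.PstarChordReadFibre (symmDiff_subset_union')
open Summit.PneNP.PneNP.Theorems.PstarCleanCut (Crosses CleanCut smallCriterion_of_crossing)
open Summit.PneNP.PneNP.Theorems.PstarCleanCutAssembly (false_of_cleanCut_two SkConnected NoTwoCrossings)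
open Summit.PneNP.PneNP.Theorems.PstarSliceGenericExact (SliceGenericExact)
open Summit.PneNP.PneNP.Theorems.PstarTwoCleanExact (MenuGeneric false_of_two_clean_exact)

namespace Summit.PneNP.PneNP.Theorems.PstarMenuCriterion

variable {n m : ℕ}

/-- **BRANCH (A), EXACT MENU**: no non-empty XOR-closed `K₀ ⊆ J₀ ∖ c` is a terminal core for a path-sum first reader `d₁` (folds `F₁`) and a
second reader `d₂` whose monomial set is EXACTLY `G ∪ F₂` (folds `F₂`), with the normal form's linear-part constraint and `d₁ ≠ d₂`. -/
def NoPathSumSubcoreExact (I : LocalMap 4 n m) (r : ℕ) (y : Fin m → Bool) (J₀ : Finset (Fin m)) (c : Fin m) (G : Finset (Fin m)) : Prop :=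
  ∀ K₀ ⊆ J₀.erase c, K₀.Nonempty → XorClosed I K₀ →
    ∀ (F₁ F₂ : Finset (Fin m)) (t : Bool) (d₁ d₂ : Finset (Fin n) × Finset (Fin m) × Bool),
      F₁ ⊆ (J₀.erase c) \ K₀ → F₂ ⊆ (J₀.erase c) \ K₀ → d₁.2.1 = F₁ → d₂.2.1 = G ∪ F₂ → d₁ ≠ d₂ →
      (∀ v, v ∈ d₁.1 ↔ Odd (xpdeg I (insert c F₁) v)) → (∀ v ∈ d₁.1, ∃ f ∈ K₀, v ∈ varSet I f) →
      (∀ v ∈ d₂.1, (∃ f ∈ K₀, v ∈ varSet I f) ∨ ∃ g ∈ d₁.2.1 ∪ d₂.2.1, I.vars g 2 = v ∨ I.vars g 3 = v) →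
      (∀ z : Fin n → Bool, (∀ f ∈ F₁, I.eval z f = y f) →
        (gval I d₁.1 d₁.2.1 z = d₁.2.2 ↔ xor (z (I.vars c 0)) (z (I.vars c 1)) = t)) →
      ¬ Terminal I r y K₀ d₁ d₂

/-- **BRANCH (A), EXACT MENU, SMALL SUB-CORES** (at most five members). -/
def NoSmallPathSumSubcoreExact (I : LocalMap 4 n m) (r : ℕ) (y : Fin m → Bool) (J₀ : Finset (Fin m)) (c : Fin m) (G : Finset (Fin m)) : Prop :=
  ∀ K₀ ⊆ J₀.erase c, K₀.Nonempty → XorClosed I K₀ → K₀.card ≤ 5 →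
    ∀ (F₁ F₂ : Finset (Fin m)) (t : Bool) (d₁ d₂ : Finset (Fin n) × Finset (Fin m) × Bool),
      F₁ ⊆ (J₀.erase c) \ K₀ → F₂ ⊆ (J₀.erase c) \ K₀ → d₁.2.1 = F₁ → d₂.2.1 = G ∪ F₂ → d₁ ≠ d₂ →
      (∀ v, v ∈ d₁.1 ↔ Odd (xpdeg I (insert c F₁) v)) → (∀ v ∈ d₁.1, ∃ f ∈ K₀, v ∈ varSet I f) →
      (∀ v ∈ d₂.1, (∃ f ∈ K₀, v ∈ varSet I f) ∨ ∃ g ∈ d₁.2.1 ∪ d₂.2.1, I.vars g 2 = v ∨ I.vars g 3 = v) →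
      (∀ z : Fin n → Bool, (∀ f ∈ F₁, I.eval z f = y f) →
        (gval I d₁.1 d₁.2.1 z = d₁.2.2 ↔ xor (z (I.vars c 0)) (z (I.vars c 1)) = t)) →
      ¬ Terminal I r y K₀ d₁ d₂

variable {I : LocalMap 4 n m} {r : ℕ} {y : Fin m → Bool} {J₀ : Finset (Fin m)} {c : Fin m}

/-- The inclusion node for a menu `M ⊇ G` gives the exact node for `G` (small sub-cores). -/
theorem noSmallPathSumSubcoreExact_of_subset {M G : Finset (Fin m)} (h : NoSmallPathSumSubcore I r y J₀ c M) (hG : G ⊆ M) :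
    NoSmallPathSumSubcoreExact I r y J₀ c G :=
  fun K₀ hK₀ hne hX h5 F₁ F₂ t d₁ d₂ hF₁ hF₂ hm₁ hm₂ hne' hlin hread hread₂ hslice =>
    h K₀ hK₀ hne hX h5 F₁ F₂ t d₁ d₂ hF₁ hF₂ hm₁ (by rw [hm₂]; exact union_subset_union hG (Subset.refl _)) hne' hlin hread hread₂ hslice

/-- Branch (B) is antitone in the menu. -/
theorem noShortCoincidence_anti {M G : Finset (Fin m)} (h : NoShortCoincidence I J₀ c M) (hG : G ⊆ M) : NoShortCoincidence I J₀ c G :=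
  fun F₁ hF₁ hne hno heven h3 h4 => h F₁ hF₁ hne (fun c' hc' hch hO => hno c' hc' hch (outsideGated_anti hG hO)) heven h3 h4

/-- Under the induction hypothesis (proper terminal sub-cores have at most five members) the small exact node gives the full one. -/
theorem noPathSumSubcoreExact_of_small {G : Finset (Fin m)}
    (hIH : ∀ K₀ ⊆ J₀.erase c, ∀ d₁ d₂ : Finset (Fin n) × Finset (Fin m) × Bool, Terminal I r y K₀ d₁ d₂ → K₀.card ≤ 5)
    (h : NoSmallPathSumSubcoreExact I r y J₀ c G) : NoPathSumSubcoreExact I r y J₀ c G :=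
  fun K₀ hK₀ hne hX F₁ F₂ t d₁ d₂ hF₁ hF₂ hm₁ hm₂ hne' hlin hread hread₂ hslice ht =>
    h K₀ hK₀ hne hX (hIH K₀ hK₀ d₁ d₂ ht) F₁ F₂ t d₁ d₂ hF₁ hF₂ hm₁ hm₂ hne' hlin hread hread₂ hslice ht

/-! ## Pair-cores for one monomial set, and the exact criterion -/

/-- **No pair-core for the readers with monomial set `G` gives exact genericity for `G`** (the proof of
`PstarTerminalPeelableTwelve.sliceGeneric_of_no_pairCore'` for one monomial set). -/
theorem sliceGenericExact_of_no_pairCore (hI : I.IsPure xorAndPred) (hT : Typed I) (hS : SimpleOverlap I) (hB : BoundaryExpanding r I)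
    {G : Finset (Fin m)} (hJr : J₀.card ≤ r) (hdisj : Disjoint J₀ G)
    (hno : ∀ K ⊆ J₀.erase c, ∀ (C : Finset (Fin n)) (t b : Bool), I.vars c 2 ∉ C → I.vars c 3 ∉ C → ¬ PairCore I y K c t (C, G, b)) :
    SliceGenericExact I y J₀ c G := by
  classical
  intro C t b hp hq hfail
  have h01 : I.vars c 0 ≠ I.vars c 1 := fun h => absurd (hI.2 c h) (by decide)
  have hJr' : (J₀.erase c).card ≤ r := (card_le_card (erase_subset c J₀)).trans hJr
  have hdisj' : Disjoint (J₀.erase c) G := hdisj.mono_left (erase_subset c J₀)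
  have hGa : ∀ g ∈ G, I.vars g 2 ≠ I.vars c 0 ∧ I.vars g 3 ≠ I.vars c 0 :=
    fun g _ => ⟨fun e => hT c g 0 2 (by decide) (by decide) e.symm, fun e => hT c g 0 3 (by decide) (by decide) e.symm⟩
  have hGb : ∀ g ∈ G, I.vars g 2 ≠ I.vars c 1 ∧ I.vars g 3 ≠ I.vars c 1 :=
    fun g _ => ⟨fun e => hT c g 1 2 (by decide) (by decide) e.symm, fun e => hT c g 1 3 (by decide) (by decide) e.symm⟩
  obtain ⟨x₁, hx₁, hx₁s⟩ : ∃ x : Fin n → Bool, (∀ j ∈ J₀.erase c, I.eval x j = y j) ∧ xor (x (I.vars c 0)) (x (I.vars c 1)) = t := by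
    have hnc : ∃ u u' : Fin n → Bool, gval I {I.vars c 0, I.vars c 1} ∅ u ≠ gval I {I.vars c 0, I.vars c 1} ∅ u' := by
      refine ⟨fun v => decide (v = I.vars c 0), fun _ => false, ?_⟩
      rw [gval_pair I h01, gval_pair I h01]
      simp [h01.symm]
    obtain ⟨x, hx, hxab⟩ := gSat n m r I hI hT hB hS y (J₀.erase c) ∅ {I.vars c 0, I.vars c 1} t hJr' (disjoint_empty_right _) hnc
    rw [gval_pair I h01] at hxab
    exact ⟨x, hx, hxab⟩
  by_cases hR : ∃ x : Fin n → Bool, (∀ j ∈ J₀.erase c, I.eval x j = y j) ∧ gval I C G x = b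
  swap
  · push Not at hR
    have hconst : ∀ u u' : Fin n → Bool, gval I C G u = gval I C G u' := by
      by_contra hnc
      push Not at hnc
      obtain ⟨u, u', huu⟩ := hnc
      obtain ⟨x, hx, hxb⟩ := gSat n m r I hI hT hB hS y (J₀.erase c) G C b hJr' hdisj' ⟨u, u', huu⟩
      exact hR x hx hxb
    exact ⟨fun _ => gval I C G x₁, fun x => hconst x x₁⟩
  obtain ⟨x₀, hx₀, hx₀b⟩ := hR
  set P : Finset (Finset (Fin m)) := (J₀.erase c).powerset.filter fun K =>
    ¬ ∃ x : Fin n → Bool, (∀ j ∈ K, I.eval x j = y j) ∧ xor (x (I.vars c 0)) (x (I.vars c 1)) = t ∧ gval I C G x = b with hP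
  have hPne : P.Nonempty := ⟨J₀.erase c, mem_filter.2 ⟨mem_powerset.2 (Subset.refl _), fun ⟨x, hx, hxs, hxb⟩ => hfail x hx hxs hxb⟩⟩
  obtain ⟨K, hKP, hKmin⟩ := exists_min_image P Finset.card hPne
  rw [mem_filter, mem_powerset] at hKP
  obtain ⟨hKsub, hKT3⟩ := hKP
  by_cases hKne : K.Nonempty
  · refine absurd ⟨hKne, hKT3, fun f hf => ?_, ⟨x₀, fun j hj => hx₀ j (hKsub hj), hx₀b⟩, ⟨x₁, fun j hj => hx₁ j (hKsub hj), hx₁s⟩⟩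
      (hno K hKsub C t b hp hq)
    by_contra hnw
    have hmem : K.erase f ∈ P := mem_filter.2 ⟨mem_powerset.2 ((erase_subset f K).trans hKsub), hnw⟩
    have := hKmin _ hmem
    rw [card_erase_of_mem hf] at this
    have hpos := card_pos.2 hKne
    omega
  · rw [not_nonempty_iff_eq_empty] at hKne
    subst hKne
    exact phi_of_forall_ne hI hS h01 hGa hGb fun x hxs hxb => hKT3 ⟨x, fun j hj => absurd hj (notMem_empty j), hxs, hxb⟩

/-- **THE EXACT-MENU CRITERION: no exact path-sum sub-core and no short coincidence (menu `G`) make the chord exactly generic for `G`.** -/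
theorem sliceGenericExact_of_criterion (hI : I.IsPure xorAndPred) (hT : Typed I) (hS : SimpleOverlap I) (hB : BoundaryExpanding r I)
    {G : Finset (Fin m)} (hcJ : c ∈ J₀) (hdisj : Disjoint J₀ G) (hr : (J₀ ∪ G).card ≤ r)
    (hA : NoPathSumSubcoreExact I r y J₀ c G) (hBc : NoShortCoincidence I J₀ c G) : SliceGenericExact I y J₀ c G := by
  classical
  have hJr : J₀.card ≤ r := (card_le_card subset_union_left).trans hr
  refine sliceGenericExact_of_no_pairCore hI hT hS hB hJr hdisj fun K hK C t b _ _ hPC => ?_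
  have hKJ : K ⊆ J₀ := hK.trans (erase_subset c J₀)
  have hcK : c ∉ K := fun h => (mem_erase.1 (hK h)).1 rfl
  have hKr : K.card < r := lt_of_lt_of_le ((card_le_card hK).trans_lt (card_erase_lt_of_mem hcJ)) hJr
  have hdisjKG : Disjoint K G := hdisj.mono_left hKJ
  have hrKG : (K ∪ G).card ≤ r := (card_le_card (union_subset_union hKJ (Subset.refl _))).trans hr
  obtain ⟨K₀, F₁, F₂, d₁, d₂, hK₀, hF₁, hF₂, -, hne, hm₁, hlin, hslice, hD₂, hX, hread, hread₂, -, -, hflip, hterm, hempty⟩ :=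
    PairCore.normalForm hI hT hS hB hPC hKr hcK hdisjKG hrKG
  have hF₁' : F₁ ⊆ K := fun f hf => (mem_sdiff.1 (hF₁ hf)).1
  have hF₂' : F₂ ⊆ K := fun f hf => (mem_sdiff.1 (hF₂ hf)).1
  by_cases hK₀e : K₀ = ∅
  · -- branch (B)
    obtain ⟨hd₁, heven, hU, hrk₁, -⟩ := hempty hK₀e
    rw [hm₁] at hrk₁
    have hF₁ne : F₁.Nonempty := by
      rw [nonempty_iff_ne_empty]
      intro hF₁e
      have h := heven (I.vars c 0)
      rw [hF₁e, insert_empty, xpdeg_singleton_of_mem I hI ((mem_xpair I).2 (Or.inl rfl))] at h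
      exact absurd h (by decide)
    have hU' : ∀ z : Fin n → Bool, ¬ (gval I ∅ F₁ z = d₁.2.2 ∧ gval I d₂.1 (G ∪ F₂) z = d₂.2.2) := by
      intro z hz
      refine hU z ⟨?_, ?_⟩
      · rw [hd₁, hm₁]; exact hz.1
      · rw [hD₂.1]; exact hz.2
    have hflip' : ∀ g ∈ K ∪ G, ∃ z : Fin n → Bool,
        (gval I ∅ F₁ z = d₁.2.2 ↔ g ∉ F₁) ∧ (gval I d₂.1 (G ∪ F₂) z = d₂.2.2 ↔ g ∉ G ∪ F₂) := by
      intro g hg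
      have hg' : g ∈ K \ K₀ ∪ G := by rw [hK₀e, sdiff_empty]; exact hg
      obtain ⟨z, -, hz₁, hz₂⟩ := hflip g hg'
      refine ⟨z, ?_, ?_⟩
      · rw [hd₁, hm₁] at hz₁; exact hz₁
      · rw [hD₂.1] at hz₂; exact hz₂
    refine hBc F₁ (hF₁'.trans hK) hF₁ne (fun c' hc' hch hO => ?_) heven (card_chords_le_two_of_rank_lt_six I hI hrk₁)
      fun M hM => card_inducedMatching_le_two_of_rank_lt_six I hM hrk₁
    exact no_chord_in_coincidence hI hS hKJ hcK hF₁' hF₂' hdisjKG (Subset.refl G) heven hU' hflip' hc' hch hO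
  · -- branch (A), exact menu
    have hK₀ne : K₀.Nonempty := nonempty_iff_ne_empty.2 hK₀e
    exact hA K₀ (hK₀.trans hK) hK₀ne hX F₁ F₂ t d₁ d₂ (hF₁.trans (sdiff_subset_sdiff hK (Subset.refl _)))
      (hF₂.trans (sdiff_subset_sdiff hK (Subset.refl _))) hm₁ hD₂.1 hne hlin hread hread₂ hslice (hterm hK₀ne)

/-! ## The joint census node and the core bound from it -/

/-- The four monomial sets the clean two-chord theorem reads: `∅` and the internal menus of `G₁`, `G₂`, `G₁ ∆ G₂`. -/
def channelMenus (I : LocalMap 4 n m) (J₀ : Finset (Fin m)) (w₁ w₂ : Finset (Fin n) × Finset (Fin m) × Bool) : Finset (Finset (Fin m)) :=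
  {∅, internalMenu I J₀ w₁.2.1, internalMenu I J₀ w₂.2.1, internalMenu I J₀ (w₁.2.1 ∆ w₂.2.1)}

/-- **`MenuCriterionBound` (OPEN, census-type, JOINT IN THE MENU)**: on every terminal core with a centre that is covered, anchored and has no
clean cut crossed twice, there is `ℬ ⊆ J₀` with `#ℬ + 2 ≤ #sharedSlots` such that every skeleton-connected outside-gated chord `c ∉ ℬ`
satisfies, for each of the four channel menus `G`, `NoSmallPathSumSubcoreExact c G` (second reader carrying `G` IN FULL) and
`NoShortCoincidence c G`.  FRONTIER. -/
@[conjecture] def MenuCriterionBound : Prop :=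
  ∀ (n m r : ℕ) (I : LocalMap 4 n m), I.IsPure xorAndPred → Typed I → SimpleOverlap I → BoundaryExpanding r I →
    ∀ (y : Fin m → Bool) (J₀ : Finset (Fin m)) (w₁ w₂ : Finset (Fin n) × Finset (Fin m) × Bool), Terminal I r y J₀ w₁ w₂ →
      (∃ S ⊆ J₀, S.Nonempty ∧ (∀ w ∈ xverts I S, 2 ≤ xpdeg I S w) ∧ ∀ f ∈ S, ¬ IsChord I J₀ f) →
      Covered I J₀ (w₁.2.1 ∪ w₂.2.1) → Anchored I J₀ (w₁.2.1 ∪ w₂.2.1) → NoTwoCrossings I J₀ (w₁.2.1 ∪ w₂.2.1) →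
      ∃ ℬ ⊆ J₀, ℬ.card + 2 ≤ (sharedSlots I J₀).card ∧
        ∀ c ∈ J₀, c ∉ ℬ → IsChord I J₀ c → OutsideGated I J₀ (w₁.2.1 ∪ w₂.2.1) c → SkConnected I J₀ (w₁.2.1 ∪ w₂.2.1) c →
          ∀ G ∈ channelMenus I J₀ w₁ w₂, NoSmallPathSumSubcoreExact I r y J₀ c G ∧ NoShortCoincidence I J₀ c G

variable {w₁ w₂ : Finset (Fin n) × Finset (Fin m) × Bool}

/-- Every channel menu lies in the internal menu of `G₁ ∪ G₂`. -/
theorem subset_of_mem_channelMenus {G : Finset (Fin m)} (hG : G ∈ channelMenus I J₀ w₁ w₂) : G ⊆ internalMenu I J₀ (w₁.2.1 ∪ w₂.2.1) := by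
  unfold channelMenus at hG
  have mono : ∀ {A B : Finset (Fin m)}, A ⊆ B → internalMenu I J₀ A ⊆ internalMenu I J₀ B := fun hAB g hg => by
    rw [PstarSliceGenericInternal.mem_internalMenu] at hg ⊢
    exact ⟨hAB hg.1, hg.2⟩
  rcases mem_insert.1 hG with rfl | hG
  · exact empty_subset _
  rcases mem_insert.1 hG with rfl | hG
  · exact mono subset_union_left
  rcases mem_insert.1 hG with rfl | hG
  · exact mono subset_union_right
  · rw [mem_singleton.1 hG]; exact mono (symmDiff_subset_union' _ _)

/-- **Exact genericity for the four menus from the per-menu criterion** (under the induction hypothesis on sub-cores). -/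
theorem menuGeneric_of_criterion (hI : I.IsPure xorAndPred) (hT : Typed I) (hS : SimpleOverlap I) (hB : BoundaryExpanding r I)
    (ht : Terminal I r y J₀ w₁ w₂) (hc : c ∈ J₀)
    (hIH : ∀ K₀ ⊆ J₀.erase c, ∀ d₁ d₂ : Finset (Fin n) × Finset (Fin m) × Bool, Terminal I r y K₀ d₁ d₂ → K₀.card ≤ 5)
    (h : ∀ G ∈ channelMenus I J₀ w₁ w₂, NoSmallPathSumSubcoreExact I r y J₀ c G ∧ NoShortCoincidence I J₀ c G) :
    MenuGeneric I y J₀ c w₁ w₂ := by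
  have hdisj : Disjoint J₀ (w₁.2.1 ∪ w₂.2.1) := disjoint_union_right.2 ⟨ht.2.2.2.1, ht.2.2.2.2.1⟩
  have hr : (J₀ ∪ (w₁.2.1 ∪ w₂.2.1)).card ≤ r := by rw [← union_assoc]; exact ht.2.2.2.2.2.1
  have gen : ∀ G ∈ channelMenus I J₀ w₁ w₂, SliceGenericExact I y J₀ c G := by
    intro G hG
    have hGsub : G ⊆ w₁.2.1 ∪ w₂.2.1 := (subset_of_mem_channelMenus hG).trans (internalMenu_subset I J₀ _)
    obtain ⟨hA, hBc⟩ := h G hG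
    exact sliceGenericExact_of_criterion hI hT hS hB hc (hdisj.mono_right hGsub)
      ((card_le_card (union_subset_union (Subset.refl _) hGsub)).trans hr) (noPathSumSubcoreExact_of_small hIH hA) hBc
  unfold channelMenus at gen
  exact ⟨gen _ (by simp), gen _ (by simp), gen _ (by simp), gen _ (by simp)⟩

/-- **THE CORE BOUND FROM O2 AND THE JOINT MENU CRITERION BOUND** — strong induction on `#J₀`. -/
theorem terminalFive_of_menuBound (hO2 : TerminalFiveA) (hb : MenuCriterionBound) : TerminalFive := by
  classical
  suffices H : ∀ (k n m r : ℕ) (I : LocalMap 4 n m), I.IsPure xorAndPred → Typed I → SimpleOverlap I → BoundaryExpanding r I →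
      ∀ (y : Fin m → Bool) (J₀ : Finset (Fin m)) (w₁ w₂ : Finset (Fin n) × Finset (Fin m) × Bool), Terminal I r y J₀ w₁ w₂ →
        J₀.card = k → J₀.card ≤ 5 from
    fun n m r I hI hT hS hB y J₀ w₁ w₂ ht => H _ n m r I hI hT hS hB y J₀ w₁ w₂ ht rfl
  intro k
  induction k using Nat.strong_induction_on with
  | _ k ih =>
    intro n m r I hI hT hS hB y J₀ w₁ w₂ ht hk
    by_cases hP : PstarChordBridgeCotree.Peelable I (nonchords I J₀)
    · obtain ⟨F, hS₀F, hFJ, hPF, hmax⟩ := exists_maximal_peelable_sup I (nonchords_subset I J₀) hP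
      refine hO2 n m r I hI hT hS hB y J₀ w₁ w₂ ht F hFJ hPF hmax fun e he => ?_
      rw [mem_sdiff] at he
      by_contra hc
      exact he.2 (hS₀F ((mem_nonchords I).2 ⟨he.1, hc⟩))
    · exfalso
      obtain ⟨S, hSJ, hne, hL, hnc⟩ := exists_centre_of_not_peelable I hP
      have hdisj : Disjoint J₀ (w₁.2.1 ∪ w₂.2.1) := disjoint_union_right.2 ⟨ht.2.2.2.1, ht.2.2.2.2.1⟩
      set 𝒢 := w₁.2.1 ∪ w₂.2.1 with h𝒢
      have hIH : ∀ c ∈ J₀, ∀ K₀ ⊆ J₀.erase c, ∀ d₁ d₂ : Finset (Fin n) × Finset (Fin m) × Bool, Terminal I r y K₀ d₁ d₂ → K₀.card ≤ 5 := by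
        intro c hc K₀ hK₀ d₁ d₂ ht₀
        have hlt : K₀.card < k := by
          rw [← hk]
          exact lt_of_le_of_lt (card_le_card hK₀) (card_erase_lt_of_mem hc)
        exact ih K₀.card hlt n m r I hI hT hS hB y K₀ d₁ d₂ ht₀ rfl
      have hN2 : NoTwoCrossings I J₀ 𝒢 := fun W e₁ e₂ he₁ he₂ hne hc₁ hc₂ hcut =>
        false_of_cleanCut_two hI hT hS hB ht hIH hcut he₁ he₂ hne hc₁ hc₂
      obtain ⟨ℬ, -, hℬ, hgood⟩ := hb n m r I hI hT hS hB y J₀ w₁ w₂ ht ⟨S, hSJ, hne, hL, hnc⟩ (covered_of_terminal hI hT hS hB ht)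
        (anchored_of_terminal hI hT hS hB ht) hN2
      obtain ⟨𝒞, h𝒞J, hch, hO, hcard⟩ := exists_clean_chords hB ht
      have hU : 1 < (𝒞 \ ℬ).card := by
        have := le_card_sdiff ℬ 𝒞
        omega
      obtain ⟨a, ha, b, hb', hab⟩ := one_lt_card.1 hU
      obtain ⟨ha𝒞, haℬ⟩ := mem_sdiff.1 ha
      obtain ⟨hb𝒞, hbℬ⟩ := mem_sdiff.1 hb'
      have hcrit : ∀ c ∈ 𝒞, c ∉ ℬ → ∀ G ∈ channelMenus I J₀ w₁ w₂,
          NoSmallPathSumSubcoreExact I r y J₀ c G ∧ NoShortCoincidence I J₀ c G := by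
        intro c hc hcℬ G hG
        by_cases hsk : SkConnected I J₀ 𝒢 c
        · exact hgood c (h𝒞J hc) hcℬ (hch c hc) (hO c hc) hsk G hG
        · unfold PstarCleanCutAssembly.SkConnected at hsk
          push Not at hsk
          obtain ⟨W, hcW, hcut⟩ := hsk
          obtain ⟨hA, hBc⟩ := smallCriterion_of_crossing (y := y) (r := r) hI hT hS hB hdisj (fun f hf hcf => hcut f hf hcf) hcW
          exact ⟨noSmallPathSumSubcoreExact_of_subset hA (subset_of_mem_channelMenus hG),
            noShortCoincidence_anti hBc (subset_of_mem_channelMenus hG)⟩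
      have hgen : ∀ c ∈ 𝒞, c ∉ ℬ → MenuGeneric I y J₀ c w₁ w₂ := fun c hc hcℬ =>
        menuGeneric_of_criterion hI hT hS hB ht (h𝒞J hc) (hIH c (h𝒞J hc)) (hcrit c hc hcℬ)
      exact false_of_two_clean_exact hI hT hS hB ht (h𝒞J ha𝒞) (h𝒞J hb𝒞) hab (hch a ha𝒞) (hch b hb𝒞) (hO a ha𝒞) (hO b hb𝒞)
        (hgen a ha𝒞 haℬ) (hgen b hb𝒞 hbℬ)

/-- **O1 from the same inputs.** -/
theorem terminalPeelable_of_menuBound (hO2 : TerminalFiveA) (hb : MenuCriterionBound) : TerminalPeelable :=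
  terminalPeelable_of_terminalFive (terminalFive_of_menuBound hO2 hb)

end Summit.PneNP.PneNP.Theorems.PstarMenuCriterion
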